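import Mathlib
import Literature.Computability.Complexity.CNF
import Literature.Computability.Complexity.PNPWave0

/-!
# `SearchHardWindow` (crux stmt-PneNP-2460, route `OverlapGapAlgebra`): the polynomial-time bound
# is load-bearing, and the kernel of Line A is a corollary of the hardness conjunct
# (negative-side support, cdisprove seat)

`SearchHardWindow` = `∃ k α, PosSat k α ∧ Hard k α`, where `Hard k α` asks that EVERY
`f : List Bool → List Bool` with `IsPolyTime f` solves `F_k(n, ⌊α n⌋)` with probability `→ 0`.
Sorry-free, definition-free records:

* `searchHardWindow_false_without_polyTime` — with `IsPolyTime f` DROPPED (hardness demanded of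
  all word functions) the statement is FALSE: the choice-function brute-force solver (decode the
  clause list through the injective `encodingCNF`, answer the table of a satisfying assignment)
  succeeds with probability `≥ Pr[sat] ≥ ε`, contradicting `→ 0`.  Any proof of the crux must use
  the running-time bound of `f` — the formal shadow of the route's relativization caveat (nothing
  that treats `f` as a black box separates it from brute force).
* `kernelHypothesis_false_of_hardness` — the HYPOTHESIS of Line A's kernel stub
  `stub_polyTimeLowDegreeSimulable` (a poly-time `f` succeeding with probability `≥ ε` for
  infinitely many `n`) contradicts `Hard k α` at the same `(k, α)`.  So the kernel (whatever its
  low-degree conclusion) FOLLOWS from the crux's hardness conjunct, and together with the named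
  fact `HuangSellke2025KSat` (checked against arXiv:2501.06427, Cor. 3.21) it is equivalent to it:
  the kernel offers no attack surface — and no proof obligation — easier than the crux itself.

Refuter `refuter-cdisprove-stmt-PneNP-2460-0` (crux disprover), 2026-08-16; companion file
`Negative/WindowBoundaries.lean`.  The statements are the literal sub-formulas of
`Summit.PneNP.PneNP.Theses.OverlapGapAlgebra.SearchHardWindow` (same binders, same `open scoped
Classical` elaboration context), stated inline so that this file depends only on the Literature
vocabulary (`encodingCNF`, `IsPolyTime`) and not on the route file.
-/

-- `Summit.PneNP.PneNP.…` is the tree's mandated namespace (summit = sub-problem name).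
set_option linter.dupNamespace false

noncomputable section

namespace Summit.PneNP.PneNP.Theorems.SearchHardWindow.Negative

open Finset Filter
open Literature.Computability.Complexity
open scoped Classical

/-- Every literal of a list has its variable below `foldr (fun l b => max (l.1 + 1) b) 0`. -/
theorem fst_lt_foldr_max_of_mem {ls : List (Literal ℕ)} {l : Literal ℕ} (h : l ∈ ls) :
    l.1 < ls.foldr (fun l b => max (l.1 + 1) b) 0 := by
  induction ls with
  | nil => cases h
  | cons hd tl ih =>
    simp only [List.foldr_cons]
    rcases List.mem_cons.1 h with rfl | h
    · exact lt_of_lt_of_le (Nat.lt_succ_self _) (le_max_left _ _)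
    · exact lt_of_lt_of_le (ih h) (le_max_right _ _)

/-- **The time bound is load-bearing.** `SearchHardWindow` with `IsPolyTime f` dropped is false:
for every `(k, α)` with uniformly positive satisfiability some word function (brute force by
choice) solves `F_k(n, ⌊α n⌋)` with probability `≥ ε` for all large `n`. -/
theorem searchHardWindow_false_without_polyTime : ¬ ∃ (k : ℕ) (α : ℝ),
    (∃ ε : ℝ, 0 < ε ∧ ∀ᶠ n : ℕ in Filter.atTop, ∀ m : ℕ, m = ⌊α * n⌋₊ → ε ≤
      ((Finset.univ.filter fun Φ : Fin m → Fin k → Fin n × Bool =>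
        ∃ σ : Fin n → Bool, ∀ i, ∃ j, σ (Φ i j).1 = (Φ i j).2).card : ℝ) /
        Fintype.card (Fin m → Fin k → Fin n × Bool)) ∧
    ∀ f : List Bool → List Bool, ∀ ε : ℝ, 0 < ε → ∀ᶠ n : ℕ in Filter.atTop, ∀ m : ℕ,
      m = ⌊α * n⌋₊ → ((Finset.univ.filter fun Φ : Fin m → Fin k → Fin n × Bool => ∀ i, ∃ j,
        (f (Literature.Computability.Complexity.encodingCNF.encode (List.ofFn fun a =>
          List.ofFn fun b => (((Φ a b).1 : ℕ), (Φ a b).2)))).getD (Φ i j).1 false =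
            (Φ i j).2).card : ℝ) / Fintype.card (Fin m → Fin k → Fin n × Bool) ≤ ε := by
  rintro ⟨k, α, ⟨ε, hε, hsat⟩, hhard⟩
  -- the brute-force solver
  set bf : List Bool → List Bool := fun w =>
    if h : ∃ φ : CNF ℕ, encodingCNF.encode φ = w ∧ ∃ τ : ℕ → Bool, ∀ c ∈ φ, ∃ l ∈ c, τ l.1 = l.2
    then List.ofFn (n := (Classical.choose h).flatten.foldr (fun l b => max (l.1 + 1) b) 0)
      (fun i => Classical.choose (Classical.choose_spec h).2 i)
    else [] with hbf
  -- its defining property on codes of satisfiable clause lists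
  have hbf_eq : ∀ w : List Bool,
      (∃ φ : CNF ℕ, encodingCNF.encode φ = w ∧ ∃ τ : ℕ → Bool, ∀ c ∈ φ, ∃ l ∈ c, τ l.1 = l.2) →
      ∃ φ : CNF ℕ, ∃ τ : ℕ → Bool, encodingCNF.encode φ = w ∧ (∀ c ∈ φ, ∃ l ∈ c, τ l.1 = l.2) ∧
        bf w = List.ofFn (n := φ.flatten.foldr (fun l b => max (l.1 + 1) b) 0) (fun i => τ i) := by
    intro w h
    refine ⟨_, _, (Classical.choose_spec h).1, Classical.choose_spec (Classical.choose_spec h).2, ?_⟩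
    rw [hbf]
    exact dif_pos h
  have hbf_solves : ∀ φ : CNF ℕ, (∃ τ : ℕ → Bool, ∀ c ∈ φ, ∃ l ∈ c, τ l.1 = l.2) →
      ∃ τ : ℕ → Bool, (∀ c ∈ φ, ∃ l ∈ c, τ l.1 = l.2) ∧
        ∀ c ∈ φ, ∀ l ∈ c, (bf (encodingCNF.encode φ)).getD l.1 false = τ l.1 := by
    intro φ hφ
    obtain ⟨φ', τ, henc, hτ, heq⟩ := hbf_eq (encodingCNF.encode φ) ⟨φ, rfl, hφ⟩
    obtain rfl : φ' = φ := encodingCNF.encode_injective henc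
    refine ⟨τ, hτ, fun c hc l hl => ?_⟩
    have hlt : l.1 < φ'.flatten.foldr (fun l b => max (l.1 + 1) b) 0 :=
      fst_lt_foldr_max_of_mem (List.mem_flatten.2 ⟨c, hc, hl⟩)
    rw [heq]
    simp [List.getD_eq_getElem?_getD, hlt]
  -- `Pr[sat] ≤ Pr[bf solves]`
  have key : ∀ n m : ℕ,
      ((Finset.univ.filter fun Φ : Fin m → Fin k → Fin n × Bool =>
        ∃ σ : Fin n → Bool, ∀ i, ∃ j, σ (Φ i j).1 = (Φ i j).2).card : ℝ) /
        Fintype.card (Fin m → Fin k → Fin n × Bool) ≤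
      ((Finset.univ.filter fun Φ : Fin m → Fin k → Fin n × Bool => ∀ i, ∃ j,
        (bf (Literature.Computability.Complexity.encodingCNF.encode (List.ofFn fun a =>
          List.ofFn fun b => (((Φ a b).1 : ℕ), (Φ a b).2)))).getD (Φ i j).1 false =
            (Φ i j).2).card : ℝ) / Fintype.card (Fin m → Fin k → Fin n × Bool) := by
    intro n m
    refine div_le_div_of_nonneg_right ?_ (Nat.cast_nonneg _)
    refine Nat.cast_le.2 (card_le_card fun Φ hΦ => ?_)
    simp only [mem_filter, mem_univ, true_and] at hΦ ⊢
    obtain ⟨σ, hσ⟩ := hΦ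
    set L : CNF ℕ := List.ofFn fun a => List.ofFn fun b => (((Φ a b).1 : ℕ), (Φ a b).2) with hL
    have hLsat : ∃ τ : ℕ → Bool, ∀ c ∈ L, ∃ l ∈ c, τ l.1 = l.2 := by
      refine ⟨fun v => if hv : v < n then σ ⟨v, hv⟩ else false, fun c hc => ?_⟩
      rw [hL] at hc
      obtain ⟨a, rfl⟩ := List.mem_ofFn.1 hc
      obtain ⟨b, hb⟩ := hσ a
      refine ⟨(((Φ a b).1 : ℕ), (Φ a b).2), List.mem_ofFn.2 ⟨b, rfl⟩, ?_⟩
      simp [hb]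
    obtain ⟨τ, hτ, hget⟩ := hbf_solves L hLsat
    intro i
    have hci : (List.ofFn fun b => (((Φ i b).1 : ℕ), (Φ i b).2)) ∈ L := by
      rw [hL]; exact List.mem_ofFn.2 ⟨i, rfl⟩
    obtain ⟨l, hl, hval⟩ := hτ _ hci
    obtain ⟨j, rfl⟩ := List.mem_ofFn.1 hl
    exact ⟨j, by rw [hget _ hci _ hl]; exact hval⟩
  -- contradiction at a common index
  obtain ⟨n, hn1, hn2⟩ := (hsat.and (hhard bf (ε / 2) (half_pos hε))).exists
  have h1 := hn1 _ rfl
  have h2 := hn2 _ rfl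
  have h3 := key n ⌊α * n⌋₊
  linarith

/-- **The kernel of Line A is a corollary of the hardness conjunct.** If `Hard k α` holds (every
poly-time `f` solves with probability `→ 0` along `m = ⌊α n⌋₊`), then no poly-time `f` succeeds
with probability `≥ ε > 0` for infinitely many `n` — i.e. the hypothesis of
`stub_polyTimeLowDegreeSimulable` (Lines/Sketch.lean) is never met, and the stub holds vacuously.
With `HuangSellke2025KSat` the converse holds too (`SearchHardWindow_of`), so kernel ⟺ hardness. -/
theorem kernelHypothesis_false_of_hardness {k : ℕ} {α : ℝ}
    (h : ∀ f : List Bool → List Bool, Literature.Computability.Complexity.IsPolyTime f → ∀ ε : ℝ,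
      0 < ε → ∀ᶠ n : ℕ in Filter.atTop, ∀ m : ℕ, m = ⌊α * n⌋₊ →
      ((Finset.univ.filter fun Φ : Fin m → Fin k → Fin n × Bool => ∀ i, ∃ j,
        (f (Literature.Computability.Complexity.encodingCNF.encode (List.ofFn fun a =>
          List.ofFn fun b => (((Φ a b).1 : ℕ), (Φ a b).2)))).getD (Φ i j).1 false =
            (Φ i j).2).card : ℝ) / Fintype.card (Fin m → Fin k → Fin n × Bool) ≤ ε)
    {f : List Bool → List Bool} (hf : IsPolyTime f) {ε : ℝ} (hε : 0 < ε)
    (hfreq : ∃ᶠ n : ℕ in atTop, ∀ m : ℕ, m = ⌊α * n⌋₊ →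
      ε * Fintype.card (Fin m → Fin k → Fin n × Bool) ≤
        ((univ.filter fun Φ : Fin m → Fin k → Fin n × Bool => ∀ i, ∃ j,
            (f (encodingCNF.encode (List.ofFn fun a => List.ofFn fun b =>
              (((Φ a b).1 : ℕ), (Φ a b).2)))).getD (Φ i j).1 false = (Φ i j).2).card : ℝ)) :
    False := by
  have hev := h f hf (ε / 2) (half_pos hε)
  obtain ⟨n, hn1, hn2, hn3⟩ := (hfreq.and_eventually (hev.and (eventually_ge_atTop 1))).exists
  have h1 := hn1 _ rfl
  have h2 := hn2 _ rfl
  have hcard : (1 : ℝ) ≤ Fintype.card (Fin ⌊α * n⌋₊ → Fin k → Fin n × Bool) := by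
    have : Nonempty (Fin ⌊α * n⌋₊ → Fin k → Fin n × Bool) := ⟨fun _ _ => (⟨0, hn3⟩, true)⟩
    exact_mod_cast Fintype.card_pos
  rw [div_le_iff₀ (by linarith)] at h2
  have h4 := h1.trans h2
  have h5 : 0 < ε * Fintype.card (Fin ⌊α * n⌋₊ → Fin k → Fin n × Bool) := by positivity
  nlinarith

end Summit.PneNP.PneNP.Theorems.SearchHardWindow.Negative

end
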